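import Mathlib
import HarnessLib
import HarnessLib.Audit
import Summits.RiemannHypothesis.Statement
import Summits.RiemannHypothesis.RiemannHypothesis.Theorems.IntegerScrewSmoothSectorDefs
import Summits.RiemannHypothesis.RiemannHypothesis.Theorems.ScrewLemmaKCoprofileCoprofileParseval
import HarnessLib.Audit.Status.Attr

/-!
Route: ScrewLemmaKCoprofile

CLOSED (proved) 2026-08-29T23:02:45Z by operator:999:95743 — reason: proved:Summit.RiemannHypothesis.RiemannHypothesis.Theorems.ScrewLemmaKCoprofile.screwSmoothSectorKSharp — note: census g0 batch2 (D-0173/D-0174): proved; reader census-reader-23-g0; evidence verified read-only by gate8 helper 2026-08-29. The file is kept as the record of this route; refuted decls are indexed as negative knowledge (`ledger negatives`).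

# Route ScrewLemmaKCoprofile — Lemma K sharp (pi^2 - 1) by the lattice co-profile — an L2 isometry
plus a three-moment Cauchy–Schwarz certificate

Column SCREW of the RH ladder, rung S-P(P1) (LADDER-RH §1; D-0061 rung leaf, never summit credit):
the leaf is LEMMA K with its
SHARP constant, `ScrewSmoothSectorKSharp := SmoothSectorKInequality (π² − 1)` — for every admissible
generator `g` (C¹ on [0,1],
`g(1) = 0`, `∫g = 0`, `∫g·u^(−1/2) = 0`) the lattice profile `h(y) = Σ_(n≤1/y) g(ny)` with plateau
`h₀ = −g(0)/2` satisfies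
`∫₀¹ (h − h₀)² y⁻² dy ≥ (π² − 1)·h₀²` (RH-free real analysis; it feeds `ScrewSmoothSectorKCertified`
(8.651) and `…KTwo` (2) by the
tree's monotonicity glue). It suffices to show X = CoprofileIsometry ∧ CoprofileMoments (+ the
generic support MomentGramFloor):
introduce the LATTICE CO-PROFILE `Φ_g(t) := Σ_(n≤1/t) g′(nt)/n`; (K1) the profile energy is its L²
norm,
`∫₀¹(h − h₀)²/y² + h₀² = (4π²)⁻¹ ∫₀¹ Φ_g²`; (K2) `Φ_g ∈ L²(0,1)` has the three moments `∫Φ_g =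
(π²/3)h₀`, `∫Φ_g√t = 0`, `∫Φ_g·t = 0`;
(K3) any `Φ ⊥ √t, t` in `L²(0,1)` has `∫Φ² ≥ 36(∫Φ)²`. Then `∫Φ_g² ≥ 36(π²/3)²h₀² = 4π⁴h₀²`, i.e.
`∫(h−h₀)²/y² ≥ (π² − 1)h₀²`
(glue `closes`: real arithmetic, elaborated). No summit is proved by this line; nothing here bears
on the truth of RH.
Lean: `Summit.RiemannHypothesis.RiemannHypothesis.Theorems.IntegerScrew.ScrewSmoothSectorKSharp`

## Assembly
Pure real arithmetic: fix admissible `g` with the integrability proviso; K2 gives `Φ_g ∈ L²` and the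
moments; K3 applied to `Φ_g`
gives `∫Φ_g² ≥ 36((π²/3)h₀)² = 4π⁴h₀²`; K1 converts: `∫(h−h₀)²/y² = (4π²)⁻¹∫Φ_g² − h₀² ≥ (π² −
1)h₀²`. The Assembly item below is
PROVED in the folder (lineB/Sketch2.lean `assembly_proof`, 12 lines of `nlinarith`, lean check rc 0)
and the deciding theorem is
`closes (h1 : CoprofileIsometry) (h2 : CoprofileMoments) (h3 : MomentGramFloor) (hA : Assembly) :
ScrewSmoothSectorKSharp := hA h1 h2 h3`.

CLOSES_TARGET: closes rung S-P(P1) of RiemannHypothesis: Summit.RiemannHypothesis.RiemannHypothesis.Theorems.IntegerScrew.ScrewSmoothSectorKSharp (D-0061; not the summit Statement) — the deciding theorem of this route concludes that registered leaf instead of the Statement decl `RiemannHypothesis` (class rung: servable and labelled, never counted as concluding the summit Statement).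

Rationale: WHY THIS LINE. WHY THIS LINE: Lemma K is the one OPEN RH-free real-analysis leaf family of the SCREW
column (`ScrewSmoothSectorK{Two,Certified,Sharp}`,
no route and no Theorems file touches `SmoothSectorKInequality`; pivot-theory gen18: «the
Paley–Wiener/Mellin steps are not in Mathlib in
this form»), and positivity/convexity (my card, KEYS-RH-IDEATORS § rh-idea-5) is its natural lever:
the sharp constant is the value of a
three-constraint minimum-norm problem, so it has a DUAL CERTIFICATE. The recorded derivation
(pub/rh-explicit/pivot/LEMMA-K-SHARP.md §1,
lineage C TRIAL-BOUND-THEOREM.md Add.3 (vii), certified 8.4924/8.651 by kit j237662) runs through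
the Hardy space H²(Re w > −½), the
outer factor ζ(2+w) and a reproducing-kernel Gram matrix. The NEW LEVER here is to pull that whole
apparatus back to the real line: the
outer factor `ζ(2+w)` IS the lattice-averaging operator `g′ ↦ Σ_n g′(n·)/n` (Müntz's formula,
Titchmarsh1986 §2.11 (2.11.1), in the tree as
`Literature…MuentzFormula.mellin_tsum_comp_mul_nat`, absolutely convergent case), the interpolation
nodes `w ∈ {0, ½, 1}` become the three
MOMENTS of `Φ_g` against `{1, √t, t}` whose Gram matrix in `L²(0,1)` is the Cauchy matrix
`(1/(aᵢ+aⱼ+1))`, `[C⁻¹]₀₀ = 36`, and the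
min-norm step is ONE Cauchy–Schwarz against `r(t) = 1 − (10/3)√t + (5/2)t`, `‖r‖² = 1/36`. What
remains complex-analytic is exactly one
isometry (K1): two Mellin–Plancherel identities on `Re w = −½` and the functional equation in
modulus,
`|ζ(−½+it)|² = (t²+¼)|ζ(3/2+it)|²/(4π²)` — a co-Poisson-type intertwining in the sense of Burnol2004
(Forum Math. 16) between `Σ g(n·)`
and `Σ g′(n·)/n`; no Hardy spaces, no Paley–Wiener, no outer-function theory. Imported areas: Mellin
analysis (Müntz/Titchmarsh; Ivić's
Parseval-for-Müntz identities, Facta Univ. 20 (2005), galaxy:pdf:8915764821623431980) and elementary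
Hilbert-space duality. Versus the
listed routes: IntegerScrew / IntegerScrewFloor* work the floor constant through the RH /
¬RH(DiscreteLandau) case split and never
touch the smooth sector; NymanBeurlingTail (closed) is a different column (dilates of ρ, conditional
expectation on Farey cells); the
negatives index (ShiftedResolvent ×2, CharacterSums, UniversalFactor) is disjoint from lattice
profiles. bears_on: S-P(P1) (feeds P2 via
`screwSmoothSectorKCertified_of_sharp`). INSTRUMENT ROW that would refute the key lemma: the
lineage-C smooth-sector Ritz engine
(lemmaK/kappa_exact.py, kit j237662–j237664): any certified admissible `g` with `κ(g) < π² − 1 =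
8.8696` kills the leaf and hence K1 or
K2 (K3 is a theorem); numerical infimum of record 8.9 ± 0.05, extremal profile κ(h*) = 8.86954
(quadrature 6e−5). Folder check
(lineB/check_isometry2.py, cubic admissible g): K1 both sides 0.003436 / 0.003434 (quadrature 6e−4
rel.), K2 moments (0.05856 vs
0.05875, −2e−4, −2e−4; exact by the ζ(s+2)-formula), K3 ratio 1.098, κ = 9.775.

RANKED CRUXES. #2 CoprofileIsometry (crux) — (K1) CO-PROFILE ISOMETRY: for admissible `g` (with the
leaf's integrability proviso), `∫₀¹ (h − h₀)² y⁻² dy + h₀² = (4π²)⁻¹ ∫₀¹ Φ_g(t)² dt`, `Φ_g(t) =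
Σ_(n≤1/t) g′(nt)/n` — Mellin–Plancherel on `Re w = −½` for the profile function `(h − h₀)1_(0,1) −
h₀1_[1,∞)` (transform `ζ(w)G(w)/w` on `−1 < Re w < 0`, `G(w) = −∫₀¹g′u^w`, Müntz continued past the
pole using `∫g = 0`, `g(1) = 0`), the functional equation in modulus, and Plancherel again for `Φ_g`
(transform `−G(w)ζ(2+w)`). [difficulty: L] (why it might fail: an identity, float-checked on one
cubic g to 6e−4 only; it fails iff the strip continuation of Müntz's formula to −1 < Re w < 0 needs
more than C¹ (a boundary term at y = 1 or the plateau normalisation ζ(0) = −½ mis-booked would shift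
it by a multiple of h₀²).) [Titchmarsh1986, Burnol2004, galaxy:pdf:8915764821623431980,
folder:lineB/check_isometry2.py, pub:rh-explicit/pivot/LEMMA-K-SHARP.md]
#3 CoprofileMoments (crux) — (K2) THREE MOMENTS: for admissible `g`, `Φ_g ∈ L²(0,1)` (indeed
`|Φ_g(t)| ≤ ‖g′‖_∞(1 + log(1/t))`) and `∫₀¹Φ_g = (π²/3)h₀`, `∫₀¹Φ_g(t)√t dt = 0`, `∫₀¹Φ_g(t)t dt =
0` — Tonelli over the lattice sum gives `∫₀¹Φ_g t^s dt = ζ(s+2)∫₀¹g′(u)u^s du` for `Re s > −1`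
(absolutely convergent Müntz, tree `mellin_tsum_comp_mul_nat` at `s+2`), then `∫g′ = −g(0) = 2h₀`,
`ζ(2) = π²/6`, and one integration by parts against each admissibility integral. [difficulty: M]
(why it might fail: routine unless the Bochner conventions bite: `deriv g` is used on (0,1) where
`ContDiffOn ℝ 1 g (Icc 0 1)` gives `derivWithin`, and the `⌊1/t⌋₊` cut-off must match `nt ≤ 1`
exactly (a half-open/closed slip changes nothing a.e., a wrong ζ(2) normalisation changes the
constant).) [Titchmarsh1986, BaezDuarte2003, folder:lineB/check_isometry2.py]
#9 MomentGramFloor (support) — (K3) GRAM FLOOR (the dual certificate; generic, no ζ): every `Φ ∈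
L²(0,1)` with `∫Φ√t = ∫Φ·t = 0` has `36(∫₀¹Φ)² ≤ ∫₀¹Φ²` — Cauchy–Schwarz against `r(t) = 1 −
(10/3)√t + (5/2)t` (`⟨Φ, r⟩ = ∫Φ`, `‖r‖² = 1/36`; `36 = [C⁻¹]₀₀` for the Cauchy/Hilbert-type Gram
matrix of `1, √t, t`). [difficulty: provable-now] [Titchmarsh1986, folder:lineB/check_isometry2.py]

TWO-LAYER PLAN. CoprofileIsometry ⇐ ProfileParseval → CoprofileParseval → CoprofileIsometry, with
ProfileParseval: `∫₀¹(h−h₀)²/y² + h₀² =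
(8π³)⁻¹∫_ℝ |G(−½+it)|²|ζ(3/2+it)|² dt` (lineage C step (2): Müntz in the strip + Plancherel +
functional equation) and CoprofileParseval:
`∫₀¹Φ_g² = (2π)⁻¹∫_ℝ |G(−½+it)ζ(3/2+it)|² dt` (absolutely convergent Müntz + Plancherel); glue = one
line of arithmetic. Filed as the
BC3 birth skeleton, not as items.

KILL CRITERIA. A certified admissible `g` with `κ(g) < π² − 1` (refutes the leaf; then K1 or K2 is
false — close `refuted:CoprofileIsometry` or
`refuted:CoprofileMoments` according to which float check breaks); a direct refutation of K1 on any
single admissible polynomial `g`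
(both sides are computable reals) closes the route outright. K3 cannot fail (finite-dimensional
Cauchy–Schwarz). If a prover lands
`ScrewSmoothSectorKSharp` by the Hardy-space proof of LEMMA-K-SHARP.md first, the route is moot
(superseded).

NOT DECOMPOSED YET. The strip continuation of Müntz's formula for `F = 1_(0,1]·g` to `−1 < Re w < 0`
(subtracting the plateau; Titchmarsh §2.11 second
half) and the Mellin–Plancherel theorem on a vertical line (via `u = e^(−v)` and Fourier–Plancherel
on ℝ) are layer-2 children of K1;
the `L^∞·log` bound for `Φ_g` and the Tonelli exchange are inside K2. Constants are fixed (π² − 1,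
36, π²/3); nothing is tunable.

CHEAPEST FALSIFIER. Evaluate both sides of K1 and the three moments of K2 for ONE admissible
polynomial `g` to high precision (exact rational
arithmetic is possible for the moments via `∫₀¹Φ_g t^s = ζ(s+2)∫₀¹g′u^s`). Done in-session at
quadrature precision
(lineB/check_isometry2.py, cubic `g = u³ + au² + bu + c`, a = −1.60714, b = 0.64286, c = −0.03571):
K1 0.003436 vs 0.003434;
moments 0.05856 vs (π²/3)h₀ = 0.05875, −2.0e−4, −2.0e−4 (all within the quadrature error of the
jumps of Φ_g at t = 1/n); κ = 9.775
≥ 8.8696. A refuter with interval arithmetic (python-flint, as kit j237662) can make this a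
certificate in minutes.

NUMBERS. π² − 1 = 8.869604 (sharp: LEMMA-K-SHARP.md THEOREM K♯, extremal `g* = ζ(2)h₀Σ_(n<1/u)
μ(n)n⁻²Q(nu)`, `Q(v) = −2 + 72v − 160v^(3/2) + 90v²`,
not C¹ — infimum not attained in the admissible class); certified lower bounds of record 8.4924 /
8.534 / 8.651 (kit j237662–j237664);
numerical infimum 8.9 ± 0.05; Gram/Cauchy matrix of `1, √t, t` on (0,1): [[1, 2/3, 1/2], [2/3, 1/2,
2/5], [1/2, 2/5, 1/3]], inverse first
row (36, −120, 90); chain constant 36·(π²/3)²/(4π²) − 1 = π² − 1 exactly.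

DEFINITION REQUESTS. None filed: the co-profile is inlined as `∑ n ∈ Finset.Icc 1 ⌊1/t⌋₊, deriv g
(n*t)/n` in K1/K2 (a named `latticeCoprofile` may be
introduced by the prover in the Theorems file). Facts available by name:
`Literature.NumberTheory.LFunctions.MuentzFormula*`
(Müntz's formula, absolutely convergent / Schwartz / compact-support strip `Re s > 0`).

Novelty: Searches (2026-08-27): `lit search --hybrid "Muntz formula Mellin transform zeta lattice sum g(nx)
functional equation Plancherel"` (8 docs, generic: Montgomery–Vaughan, Jorgenson–Lang; no
Lemma-K-type inequality); `lit galaxy search "Müntz formula|Muntz formula|co-Poisson" --star all`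
(20 rows: [galaxy:panama:346449241964576] = Titchmarsh §2.11 p.24 (2.11.1)
[corpus:book:titchmarsh1986-theory-riemann-zeta-function-2nd-ed-revised p.24];
[galaxy:pdf:312351706566838340] Burnol, On Fourier and Zeta(s), Forum Math 16 (2004) — co-Poisson;
[galaxy:pdf:8915764821623431980] Ivić, Some identities for the Riemann zeta-function II (2005) —
Parseval for Müntz transforms, cites Báez-Duarte's Müntz-convolution remark p.3); `lit galaxy search
"Dualizing the Poisson|dual Poisson summation" --star pdf` (4: Faifman arXiv:1111.4660 Poisson-type
unitary operators; Burnol math/0203120); `lean search plancherel|mellin_comp` (tree: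
MuentzFormula{,Schwartz,Strip}.lean, HalfPlanePaleyWiener.lean; no Mellin–Plancherel on a vertical
line as such); tree grep `SmoothSectorKInequality` (Defs file only).
Nearest prior art found: pub:rh-explicit/pivot/LEMMA-K-SHARP.md §1
(Hardy-space/outer-factor/reproducing-kernel derivation of π² − 1, DERIVED, not typed) and lineage C
TRIAL-BOUND-THEOREM.md Add.3 (vii) (three-point weighted interpolation with a MINORANT of
|ζ(3/2+it)|², certified 8.651); in print, Müntz's formula (Titchmarsh1986 §2.11) and Ivić 2005's
Mellin–Parseval identities for Müntz transforms on the  [refs: 1111.4660, book:titchmarsh1986-theory-riemann-zeta-function-2nd-ed-revised, Titchmarsh1986]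

Barriers (technique_class: positivity-certificate, mellin-plancherel, lattice-sums): - technique_class: positivity-certificate, mellin-plancherel, lattice-sums
- Literature.Barriers.RiemannHypothesis.DeBrangesPositivity: outside — Conrey–Li refute positivity
of de Branges' form built from ξ; the only positivity used here is of the 3×3 Cauchy Gram matrix of
`1, √t, t` in L²(0,1) (positive definite by Cauchy's determinant) — no de Branges space, no
ξ-kernel.
- Negatives index: empty intersection at filing (4 refuted statements: ShiftedResolvent 15969/15970,
CharacterSums 16980, UniversalFactor 2575 — none about lattice profiles, Müntz transforms or the
smooth sector).

History (route lifecycle, newest last):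
- 2026-08-29T23:02:45Z · CLOSED proved — proved:Summit.RiemannHypothesis.RiemannHypothesis.Theorems.ScrewLemmaKCoprofile.screwSmoothSectorKSharp (operator:999:95743)

sub-problem: RiemannHypothesis · status: closed(proved) · opened planner-rh-idea-5-g0-0 2026-08-27T20:16:07Z · rev 0 · ledger route-RiemannHypothesis-ScrewLemmaKCoprofile
GENERATED by the gate from the ledger (D-0016/17). Provers cite these decls: `theorem foo : Summit.RiemannHypothesis.RiemannHypothesis.Theses.ScrewLemmaKCoprofile.<Decl> := …` in Summits/RiemannHypothesis/RiemannHypothesis/Theorems/<Name>.lean.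
-/

namespace Summit.RiemannHypothesis.RiemannHypothesis.Theses.ScrewLemmaKCoprofile

open scoped BigOperators Topology Manifold Classical MeasureTheory ProbabilityTheory Matrix InnerProductSpace ComplexConjugate ContinuousMap
open Filter Set Function TopologicalSpace MeasureTheory

attribute [summit_statement] _root_.Summit.RiemannHypothesis
attribute [summit_statement] _root_.Summit.RiemannHypothesis.RiemannHypothesis.Theorems.IntegerScrew.ScrewSmoothSectorKSharp

open Summit

/-- item stmt-RiemannHypothesis-21612 · crux · rank 2 · closed · proved by Summit.RiemannHypothesis.RiemannHypothesis.Theorems.ScrewLemmaKCoprofile.coprofileIsometry_proof (prover) · by planner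
why it might fail: an identity, float-checked on one cubic g to 6e−4 only; it fails iff the strip continuation of Müntz's formula to −1 < Re w < 0 needs more than C¹ (a boundary term at y = 1 or the plateau normalisation ζ(0) = −½ mis-booked would shift it by a multiple of h₀²).
sources: Titchmarsh1986, Burnol2004, galaxy:pdf:8915764821623431980, folder:lineB/check_isometry2.py, pub:rh-explicit/pivot/LEMMA-K-SHARP.md
[crux] (K1) CO-PROFILE ISOMETRY: for admissible `g` (with the leaf's integrability proviso), `∫₀¹ (h
− h₀)² y⁻² dy + h₀² = (4π²)⁻¹ ∫₀¹ Φ_g(t)² dt`, `Φ_g(t) = Σ_(n≤1/t) g′(nt)/n` — Mellin–Plancherel on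
`Re w = −½` for the profile function `(h − h₀)1_(0,1) − h₀1_[1,∞)` (transform `ζ(w)G(w)/w` on `−1 <
Re w < 0`, `G(w) = −∫₀¹g′u^w`, Müntz continued past the pole using `∫g = 0`, `g(1) = 0`), the
functional equation in modulus, and Plancherel again for `Φ_g` (transform `−G(w)ζ(2+w)`).
[difficulty: L] -/
@[route_item "route-RiemannHypothesis-ScrewLemmaKCoprofile", crux]
def CoprofileIsometry : Prop :=
  ∀ g : ℝ → ℝ, Summit.RiemannHypothesis.RiemannHypothesis.Theorems.IntegerScrew.SmoothSectorAdmissible g → IntegrableOn (fun y => (Summit.RiemannHypothesis.RiemannHypothesis.Theorems.IntegerScrew.latticeProfile g y - Summit.RiemannHypothesis.RiemannHypothesis.Theorems.IntegerScrew.latticePlateau g) ^ 2 / y ^ 2) (Set.Ioo 0 1) → (∫ y in Set.Ioo (0:ℝ) 1, (Summit.RiemannHypothesis.RiemannHypothesis.Theorems.IntegerScrew.latticeProfile g y - Summit.RiemannHypothesis.RiemannHypothesis.Theorems.IntegerScrew.latticePlateau g) ^ 2 / y ^ 2) + Summit.RiemannHypothesis.RiemannHypothesis.Theorems.IntegerScrew.latticePlateau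 g ^ 2 = (1 / (4 * Real.pi ^ 2)) * ∫ t in Set.Ioo (0:ℝ) 1, (∑ n ∈ Finset.Icc 1 ⌊1 / t⌋₊, deriv g (n * t) / n) ^ 2

-- `CoprofileIsometry` holds: proved by `Summit.RiemannHypothesis.RiemannHypothesis.Theorems.ScrewLemmaKCoprofile.coprofileIsometry_proof` (its module imports this route file, so no `_holds` link can be stated here).

/-- item stmt-RiemannHypothesis-21613 · crux · rank 3 · closed · proved by Summit.RiemannHypothesis.RiemannHypothesis.Theorems.ScrewLemmaKCoprofile.coprofileMoments_proof (prover) · by planner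
why it might fail: routine unless the Bochner conventions bite: `deriv g` is used on (0,1) where `ContDiffOn ℝ 1 g (Icc 0 1)` gives `derivWithin`, and the `⌊1/t⌋₊` cut-off must match `nt ≤ 1` exactly (a half-open/closed slip changes nothing a.e., a wrong ζ(2) normalisation changes the constant).
sources: Titchmarsh1986, BaezDuarte2003, folder:lineB/check_isometry2.py
[crux] (K2) THREE MOMENTS: for admissible `g`, `Φ_g ∈ L²(0,1)` (indeed `|Φ_g(t)| ≤ ‖g′‖_∞(1 +
log(1/t))`) and `∫₀¹Φ_g = (π²/3)h₀`, `∫₀¹Φ_g(t)√t dt = 0`, `∫₀¹Φ_g(t)t dt = 0` — Tonelli over the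
lattice sum gives `∫₀¹Φ_g t^s dt = ζ(s+2)∫₀¹g′(u)u^s du` for `Re s > −1` (absolutely convergent
Müntz, tree `mellin_tsum_comp_mul_nat` at `s+2`), then `∫g′ = −g(0) = 2h₀`, `ζ(2) = π²/6`, and one
integration by parts against each admissibility integral. [difficulty: M] -/
@[route_item "route-RiemannHypothesis-ScrewLemmaKCoprofile", crux]
def CoprofileMoments : Prop :=
  ∀ g : ℝ → ℝ, Summit.RiemannHypothesis.RiemannHypothesis.Theorems.IntegerScrew.SmoothSectorAdmissible g → MemLp (fun t : ℝ => ∑ n ∈ Finset.Icc 1 ⌊1 / t⌋₊, deriv g (n * t) / n) 2 (volume.restrict (Set.Ioo (0:ℝ) 1)) ∧ (∫ t in Set.Ioo (0:ℝ) 1, ∑ n ∈ Finset.Icc 1 ⌊1 / t⌋₊, deriv g (n * t) / n) = (Real.pi ^ 2 / 3) * Summit.RiemannHypothesis.RiemannHypothesis.Theorems.IntegerScrew.latticePlateau g ∧ (∫ t in Set.Ioo (0:ℝ) 1, (∑ n ∈ Finset.Icc 1 ⌊1 / t⌋₊, deriv g (n * t) / n) * Real.sqrt t) = 0 ∧ (∫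 t in Set.Ioo (0:ℝ) 1, (∑ n ∈ Finset.Icc 1 ⌊1 / t⌋₊, deriv g (n * t) / n) * t) = 0

-- `CoprofileMoments` holds: proved by `Summit.RiemannHypothesis.RiemannHypothesis.Theorems.ScrewLemmaKCoprofile.coprofileMoments_proof` (its module imports this route file, so no `_holds` link can be stated here).

/-- item stmt-RiemannHypothesis-21614 · support · rank 9 · closed · proved by Summit.RiemannHypothesis.RiemannHypothesis.Theorems.ScrewLemmaKCoprofile.momentGramFloor_proof (prover) · by planner
sources: Titchmarsh1986, folder:lineB/check_isometry2.py
[support] (K3) GRAM FLOOR (the dual certificate; generic, no ζ): every `Φ ∈ L²(0,1)` with `∫Φ√t =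
∫Φ·t = 0` has `36(∫₀¹Φ)² ≤ ∫₀¹Φ²` — Cauchy–Schwarz against `r(t) = 1 − (10/3)√t + (5/2)t` (`⟨Φ, r⟩ =
∫Φ`, `‖r‖² = 1/36`; `36 = [C⁻¹]₀₀` for the Cauchy/Hilbert-type Gram matrix of `1, √t, t`).
[difficulty: provable-now] -/
@[route_item "route-RiemannHypothesis-ScrewLemmaKCoprofile", crux]
def MomentGramFloor : Prop :=
  ∀ Φ : ℝ → ℝ, MemLp Φ 2 (volume.restrict (Set.Ioo (0:ℝ) 1)) → (∫ t in Set.Ioo (0:ℝ) 1, Φ t * Real.sqrt t) = 0 → (∫ t in Set.Ioo (0:ℝ) 1, Φ t * t) = 0 → 36 * (∫ t in Set.Ioo (0:ℝ) 1, Φ t) ^ 2 ≤ ∫ t in Set.Ioo (0:ℝ) 1, Φ t ^ 2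

-- `MomentGramFloor` holds: proved by `Summit.RiemannHypothesis.RiemannHypothesis.Theorems.ScrewLemmaKCoprofile.momentGramFloor_proof` (its module imports this route file, so no `_holds` link can be stated here).

/-- item stmt-RiemannHypothesis-22439 · support · rank 9 · closed · proved by Summit.RiemannHypothesis.RiemannHypothesis.Theorems.ScrewLemmaKCoprofile.coprofileParseval (prover) · by planner
[support] (K1c) CO-PROFILE PARSEVAL, the L17↔L14 bridge: ∫₀¹Φ_g² = (2π)⁻¹∫_ℝ |G(−½+it)|²|ζ(3/2+it)|²
dt with G(w) = ∫₀¹ g′(u)u^w du — Mellin of Φ_g = Σ g′(n·)/n is ζ(1+s)·𝓜(g′1_(0,1))(s) for Re s > 0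
(absolutely convergent Müntz, tree MuentzFormula.mellin_tsum_comp_mul_nat) + Mellin–Plancherel on Re
s = ½. With K2+K3 it PROVES L14 HardyThreePointBound (stmt-21566: 36(∫Φ)² ≤ ∫Φ², ∫Φ = −π²g(0)/6 ⇒
∫|Gζ|² ≥ 2π⁵g(0)²) without Hardy spaces; with L14 ProfileMellinFormula+ProfileParsevalFE
(21565/21567) it gives K1 CoprofileIsometry (21612). why it might fail: only mis-normalisation (2π,
sign of G irrelevant under the norm); integrability of |Gζ|² follows from ∫|G(−½+it)|²dt = 2π∫g′²
and |ζ(3/2+it)| ≤ ζ(3/2). sources: Titchmarsh1986 §2.11, galaxy:pdf:8915764821623431980 (Ivić 2005),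
route SmoothSectorHardy. -/
@[route_item "route-RiemannHypothesis-ScrewLemmaKCoprofile"]
def CoprofileParseval : Prop :=
  ∀ g : ℝ → ℝ, Summit.RiemannHypothesis.RiemannHypothesis.Theorems.IntegerScrew.SmoothSectorAdmissible g → (∫ t in Set.Ioo (0:ℝ) 1, (∑ n ∈ Finset.Icc 1 ⌊1 / t⌋₊, deriv g (n * t) / n) ^ 2) = (1 / (2 * Real.pi)) * ∫ t : ℝ, ‖∫ u in Set.Ioo (0:ℝ) 1, ((deriv g u : ℝ) : ℂ) * (u : ℂ) ^ (-(1 / 2 : ℂ) + t * Complex.I)‖ ^ 2 * ‖riemannZeta (3 / 2 + t * Complex.I)‖ ^ 2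

/-- `CoprofileParseval` holds: proved by `Summit.RiemannHypothesis.RiemannHypothesis.Theorems.ScrewLemmaKCoprofile.coprofileParseval`. -/
theorem CoprofileParseval_holds : CoprofileParseval := _root_.Summit.RiemannHypothesis.RiemannHypothesis.Theorems.ScrewLemmaKCoprofile.coprofileParseval

/-- item stmt-RiemannHypothesis-21615 · assembly · rank 1 · closed · proved by Summit.RiemannHypothesis.RiemannHypothesis.Theorems.ScrewLemmaKCoprofile.assembly_proof (prover) · by planner
sources: folder:lineB/Sketch2.lean
[assembly] CoprofileIsometry → CoprofileMoments → MomentGramFloor → Lemma K with the sharp constant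
π² − 1 (the rung leaf `ScrewSmoothSectorKSharp`). -/
@[route_item "route-RiemannHypothesis-ScrewLemmaKCoprofile", crux]
def Assembly : Prop :=
  CoprofileIsometry → CoprofileMoments → MomentGramFloor → Summit.RiemannHypothesis.RiemannHypothesis.Theorems.IntegerScrew.ScrewSmoothSectorKSharp

-- `Assembly` holds: proved by `Summit.RiemannHypothesis.RiemannHypothesis.Theorems.ScrewLemmaKCoprofile.assembly_proof` (its module imports this route file, so no `_holds` link can be stated here).

/-! D-0027 §2.1 — DECIDING THEOREM (planner-authored via `route open/edit --closes-file`; by planner-rh-idea-5-g0-0 2026-08-27T20:16:07Z) — ARCHIVED: route closed (proved) 2026-08-29T23:02:45Z; kept so importers keep building: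
its hypotheses are this route's items and its conclusion the registered leaf `Summit.RiemannHypothesis.RiemannHypothesis.Theorems.IntegerScrew.ScrewSmoothSectorKSharp` (rung S-P(P1), D-0061) (glue_lint), and it elaborates with this file. -/

-- glue.lean — DECIDING THEOREM of route ScrewLemmaKCoprofile (D-0027 §2.1; D-0061 rung leaf S-P(P1)
-- `Summit.RiemannHypothesis.RiemannHypothesis.Theorems.IntegerScrew.ScrewSmoothSectorKSharp` BY NAME). Every binder is consumed;
-- the Assembly item is proved in the planner folder (lineB/Sketch2.lean `assembly_proof`: real arithmetic, nlinarith).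
@[closes "route-RiemannHypothesis-ScrewLemmaKCoprofile"] theorem closes (h1 : CoprofileIsometry) (h2 : CoprofileMoments) (h3 : MomentGramFloor) (hA : Assembly) :
    Summit.RiemannHypothesis.RiemannHypothesis.Theorems.IntegerScrew.ScrewSmoothSectorKSharp :=
  hA h1 h2 h3

end Summit.RiemannHypothesis.RiemannHypothesis.Theses.ScrewLemmaKCoprofile
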